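import Summits.ABC.IUTFork.Repair.RHQ3LTailSigma8Target
import Summits.ABC.IUTFork.Repair.RHHeightClassRealising
import HarnessLib

/-!
# D-0079 RESCUE sub-cell R-H, ROUND 2 Q3 × Q2 — the l-TAIL OF THE `hSHw` BODY ITSELF: at every [IUTchI] Def. 3.1 datum with `K/ℚ` Galois of level
# `l ≥ l₀(E)`, the (xi-f) hull inclusion `qRegion ⊆ thetaHull` holds at EVERY packet for the certificates' CHOSEN realising ideles — AS A THEOREM
# (seat abc-iut-rh2-q3-typ-1 g2)

PROOF-ONLY composition (0 definitions, 0 new hypotheses) of this lane's tail theorems `RH.Q3LTailSigma8.inSigma8_of_ltail_of_isGalois` (p478328) /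
`lTailSigma8_holds` (p479487: Q3(row 8) YES per curve on Galois data) with abc-iut-rp-m2's door `RHHeightClassRealising.qRegion_subset_thetaHull_pilotDataOfK_chosen_of_inSigma8`
/ `exists_qPinned_and_hull_pilotDataOfK_chosen_of_inSigma8` (p473818: `InSigma8 D` ALONE ⟹ the body of the binder `hSHw` of `Conditional.abc_of_SH_v10K_window`
at the CHOSEN realising ideles, analytic logarithms). Rung LADDER-ABC:A2.RESCUE.H; ROUND2 READING §Q3 / «ANSWER TO THE RESCUE QUESTION». TAKES NO SIDE on
[IUTchIII] Cor. 3.12 or on any author; NOTHING HERE ASSERTS abc: the certificate consumes `hSHw` at ALL admissible `(P, l)` of its window `l ≍ √(log q∀)`,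
whereas the tail below starts at `l₀(E)` EXPONENTIAL in the local heights of the curve (`RHQ3LTailSigma8Window.not_inSigma8_datum_of_heavy_of_le`: heavy data are
OUTSIDE Σ₈ throughout their window) — this file says exactly and only that the `hSHw` BODY is a theorem in the tail of each curve.

* `qRegion_subset_thetaHull_pilotDataOfK_chosen_of_ltail_of_isGalois` — `K/ℚ` Galois + the per-place tail test (`p^t ≤ l`, `ord_v(q_v) + 4e(v|p) ≤ 4e(v|p)·t`)
  ⟹ `qRegion j vQ ⊆ thetaHull j vQ` at every `(j, vQ)` (any Frobenioid-signature / region / column parameters);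
* `exists_qPinned_and_hull_pilotDataOfK_chosen_of_ltail_of_isGalois` — the bundled «`∃ ρ qK, QPinned ∧ PilotKummerCompatHull`» form;
* **`exists_l0_qRegion_subset_thetaHull_of_isGalois`** — PER CURVE: `∃ l₀(E)`, for every `l ≥ l₀` and every Def. 3.1 datum of level `l` over `(F, E_F)` with
  `K/ℚ` Galois, the hull inclusion holds at every packet (from `lTailSigma8_holds`, `l₀ = max_{v∣Δmin} p_v^{ord_v(Δ_min)+1}`).
[cite: Mochizuki2012, IUTchI Def. 3.1 (b)(c) pp. 61–62, Ex. 3.2 (iv) p. 71; IUTchIII Cor. 3.12 pp. 173–174; IUTchIV Prop. 1.2 (i)(ii) p. 10]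
[cite: DupuyHilado2025, §3.3, §3.4, §3.9] [cite: SilvermanAEC2009, VII.5 Prop. 5.1(b), VIII.8] [claim: Mochizuki2012, status: disputed] for every IUT locution.
-/

noncomputable section

open Set Metric Function
open scoped Pointwise

namespace Summit.ABC.IUTFork.Repair.RH.Q3LTailSigma8

open NumberField IsDedekindDomain Literature.IUT.LogThetaLattice Literature.IUT.LogVolume Literature.IUT.HodgeTheaters
  Literature.IUT.LogVolume.ThetaData Literature.NumberTheory.NumberFields Literature.NumberTheory.GaloisRepresentations.Ultrametric
  Summit.ABC.IUTFork.Thm311 Summit.ABC.IUTFork.Thm311.Real Summit.ABC.IUTFork.Cor312 Summit.ABC.IUTFork.Cor312.Setting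
  Summit.ABC.IUTFork.Cor312Vol Summit.ABC.IUTFork.Cor312Prov Summit.ABC.IUTFork.Repair.RHHeightClassRealising

section Chosen

variable {F K Fbar : Type} [Field F] [NumberField F] [Field K] [NumberField K] [Algebra F K] [Field Fbar]
  [Algebra F Fbar] [Algebra K Fbar] {E : WeierstrassCurve F} [E.IsElliptic] {l : ℕ} {Pb : BadPlacePredicates K}
  (D : InitialThetaData F K Fbar E l Pb) (M : Type) [Field M] [NumberField M]
  (archPk : ∀ (j : (thetaIndex (pilotDataOfK D K)).Label) (vQ : (thetaIndex (pilotDataOfK D K)).VQ),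
    Set ((logShellsDH (pilotDataOfK D K) (analyticLogv K)).Packet j vQ))
  (archSub : ∀ (j : (thetaIndex (pilotDataOfK D K)).Label) (v : (thetaIndex (pilotDataOfK D K)).V),
    Set ((logShellsDH (pilotDataOfK D K) (analyticLogv K)).Packet j ((thetaIndex (pilotDataOfK D K)).over v)))
  (Ψ : ℤ → ∀ v : (thetaIndex (pilotDataOfK D K)).V, v ∈ (thetaIndex (pilotDataOfK D K)).Vbad →
    Set ((logShellsDH (pilotDataOfK D K) (analyticLogv K)).StarPacket v))
  (act : ℤ → ∀ v : (thetaIndex (pilotDataOfK D K)).V, v ∈ (thetaIndex (pilotDataOfK D K)).Vbad →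
    (logShellsDH (pilotDataOfK D K) (analyticLogv K)).StarPacket v →
      Module.End ℚ ((logShellsDH (pilotDataOfK D K) (analyticLogv K)).StarPacket v))
  (Mmod : ℤ → ∀ j : (thetaIndex (pilotDataOfK D K)).LabelStar, Set ((logShellsDH (pilotDataOfK D K) (analyticLogv K)).GlobalPacket j.1))
  (region : ℤ → ∀ j : (thetaIndex (pilotDataOfK D K)).LabelStar, FinDivisor M → ∀ vQ : (thetaIndex (pilotDataOfK D K)).VQ,
    Set ((logShellsDH (pilotDataOfK D K) (analyticLogv K)).Packet j.1 vQ))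
  (n : ℤ) {HT : Type} {LogLink : HT → HT → Type} {IsFull : ∀ {s t : HT}, LogLink s t → Prop}
  (lat : LGPGaussianLogThetaLattice LogLink IsFull)
  {Frd : Type} {IsoF : Frd → Frd → Type} {Ob : Frd → Type} {realify : Frd → Frd} {Strip : Type}
  {IsoS : Strip → Strip → Type}
  {Mv : ∀ v : (thetaIndex (pilotDataOfK D K)).V, v ∈ (thetaIndex (pilotDataOfK D K)).Vbad → Type} [∀ v h, Monoid (Mv v h)]
  (sig : GlobalLGPFrobenioidSignature (thetaIndex (pilotDataOfK D K)).lstar (thetaIndex (pilotDataOfK D K)).V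
    (· ∈ (thetaIndex (pilotDataOfK D K)).Vbad) Frd IsoF Ob realify Strip IsoS Mv)
  (split : SplittingMonoids Mv) {ObΔ : Type}
  {N : ∀ v : (thetaIndex (pilotDataOfK D K)).V, v ∈ (thetaIndex (pilotDataOfK D K)).Vbad → Type} [∀ v h, Monoid (N v h)]
  (qData : QPilotData ObΔ N)
  (col : ℤ → Column (logShellsDH (pilotDataOfK D K) (analyticLogv K)))

/-- **THE `hSHw` BODY IN THE TAIL, BUNDLED.** For `K/ℚ` Galois and the per-place tail test at every bad place, the genuine datum satisfies
«`∃ ρ qK, QPinned ∧ PilotKummerCompatHull`» at the certificates' chosen realising ideles (abc-iut-rp-m2's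
`exists_qPinned_and_hull_pilotDataOfK_chosen_of_inSigma8` ∘ `inSigma8_of_ltail_of_isGalois`). [cite: Mochizuki2012, IUTchI Ex. 3.2 (iv) p. 71; IUTchIII Cor. 3.12 pp. 173–174]
[cite: DupuyHilado2025, §3.9] [claim: Mochizuki2012, status: disputed] -/
theorem exists_qPinned_and_hull_pilotDataOfK_chosen_of_ltail_of_isGalois [IsGalois ℚ K]
    (htail : ∀ (pp : Nat.Primes) (w : (thetaIndex (pilotDataOfK D K)).Fibre (.inr pp)),
      haveI : Fact (pp : ℕ).Prime := ⟨pp.2⟩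
      placeOf (pilotDataOfK D K) pp.1 w ∈ (pilotDataOfK D K).S →
        ∃ t : ℕ, (pp : ℕ) ^ t ≤ l ∧
          qParamOrd E (finBelow F K (placeOf (pilotDataOfK D K) pp.1 w)) + 4 * ramIdx F (finBelow F K (placeOf (pilotDataOfK D K) pp.1 w)) ≤
            4 * ramIdx F (finBelow F K (placeOf (pilotDataOfK D K) pp.1 w)) * t) :
    ∃ (ρ' : (∀ v : (thetaIndex (pilotDataOfK D K)).V, v ∈ (thetaIndex (pilotDataOfK D K)).Vbad →
            Set ((logShellsDH (pilotDataOfK D K) (analyticLogv K)).StarPacket v)) →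
          ∀ (j : (thetaIndex (pilotDataOfK D K)).Label) (vQ : (thetaIndex (pilotDataOfK D K)).VQ),
            Set ((logShellsDH (pilotDataOfK D K) (analyticLogv K)).Packet j vQ))
        (qK : ∀ v : (thetaIndex (pilotDataOfK D K)).V, v ∈ (thetaIndex (pilotDataOfK D K)).Vbad →
          Set ((logShellsDH (pilotDataOfK D K) (analyticLogv K)).StarPacket v)),
        QPinned
          ({ toSituation := situationPrVol (pilotDataOfK D K) (logvAnalytic_analyticLogv (F := K)) M archPk archSub Ψ act Mmod region,
             col := col } : LatticeSituation (thetaIndex (pilotDataOfK D K)))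
          (settingPrVolSharp (pilotDataOfK D K) (logvAnalytic_analyticLogv (F := K)) M archPk archSub Ψ act Mmod region n lat sig split
            qData (exists_realising_qIdeles_pilotDataOfK D).choose (exists_realising_thetaIdeles_pilotDataOfK D).choose
            (exists_realising_qIdeles_pilotDataOfK D).choose_spec.1 (exists_realising_qIdeles_pilotDataOfK D).choose_spec.2.1) ρ' qK ∧
        PilotKummerCompatHull
          ({ toSituation := situationPrVol (pilotDataOfK D K) (logvAnalytic_analyticLogv (F := K)) M archPk archSub Ψ act Mmod region,
             col := col } : LatticeSituation (thetaIndex (pilotDataOfK D K)))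
          (settingPrVolSharp (pilotDataOfK D K) (logvAnalytic_analyticLogv (F := K)) M archPk archSub Ψ act Mmod region n lat sig split
            qData (exists_realising_qIdeles_pilotDataOfK D).choose (exists_realising_thetaIdeles_pilotDataOfK D).choose
            (exists_realising_qIdeles_pilotDataOfK D).choose_spec.1 (exists_realising_qIdeles_pilotDataOfK D).choose_spec.2.1) ρ' qK :=
  exists_qPinned_and_hull_pilotDataOfK_chosen_of_inSigma8 D M archPk archSub Ψ act Mmod region n lat sig split qData col
    (inSigma8_of_ltail_of_isGalois D htail)

include col in
/-- **THE `hSHw` BODY IN THE TAIL, per packet**: `K/ℚ` Galois + the tail test ⟹ `qRegion j vQ ⊆ thetaHull j vQ` at EVERY label `j` and place `vQ`, for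
the chosen realising ideles and ANY signature/region/column parameters — literally what `hSHw` of `Conditional.abc_of_SH_v10K_window` asks of the datum,
here a THEOREM for the data in the tail of their curve. [cite: Mochizuki2012, IUTchIII Cor. 3.12 pp. 173–174] [claim: Mochizuki2012, status: disputed] -/
theorem qRegion_subset_thetaHull_pilotDataOfK_chosen_of_ltail_of_isGalois [IsGalois ℚ K]
    (htail : ∀ (pp : Nat.Primes) (w : (thetaIndex (pilotDataOfK D K)).Fibre (.inr pp)),
      haveI : Fact (pp : ℕ).Prime := ⟨pp.2⟩
      placeOf (pilotDataOfK D K) pp.1 w ∈ (pilotDataOfK D K).S →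
        ∃ t : ℕ, (pp : ℕ) ^ t ≤ l ∧
          qParamOrd E (finBelow F K (placeOf (pilotDataOfK D K) pp.1 w)) + 4 * ramIdx F (finBelow F K (placeOf (pilotDataOfK D K) pp.1 w)) ≤
            4 * ramIdx F (finBelow F K (placeOf (pilotDataOfK D K) pp.1 w)) * t)
    (j : (thetaIndex (pilotDataOfK D K)).Label) (vQ : (thetaIndex (pilotDataOfK D K)).VQ) :
    (settingPrVolSharp (pilotDataOfK D K) (logvAnalytic_analyticLogv (F := K)) M archPk archSub Ψ act Mmod region n lat sig split
        qData (exists_realising_qIdeles_pilotDataOfK D).choose (exists_realising_thetaIdeles_pilotDataOfK D).choose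
        (exists_realising_qIdeles_pilotDataOfK D).choose_spec.1 (exists_realising_qIdeles_pilotDataOfK D).choose_spec.2.1).qRegion j vQ ⊆
      (settingPrVolSharp (pilotDataOfK D K) (logvAnalytic_analyticLogv (F := K)) M archPk archSub Ψ act Mmod region n lat sig split
        qData (exists_realising_qIdeles_pilotDataOfK D).choose (exists_realising_thetaIdeles_pilotDataOfK D).choose
        (exists_realising_qIdeles_pilotDataOfK D).choose_spec.1 (exists_realising_qIdeles_pilotDataOfK D).choose_spec.2.1).thetaHull j vQ :=
  qRegion_subset_thetaHull_pilotDataOfK_chosen_of_inSigma8 D M archPk archSub Ψ act Mmod region n lat sig split qData col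
    (inSigma8_of_ltail_of_isGalois D htail) j vQ

end Chosen

/-! ## The per-curve form: `∃ l₀(E)` beyond which the `hSHw` body is a theorem at every Galois datum of the curve -/

section Curve

variable (F : Type) [Field F] [NumberField F] (E : WeierstrassCurve F) [E.IsElliptic]

/-- **PER CURVE: THE `hSHw` BODY IS A THEOREM IN THE TAIL (Galois data).** There is `l₀ = l₀(E)` (`max_{v∣Δmin} p_v^{ord_v(Δ_min)+1}`, `lTailSigma8_holds`)
such that for every `l ≥ l₀`, every [IUTchI] Def. 3.1 initial Θ-datum `D` of level `l` over `(F, E_F)` with `K/ℚ` Galois, every Frobenioid-signature /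
region / column parameter, and every packet `(j, vQ)`: `qRegion j vQ ⊆ thetaHull j vQ` at the certificates' chosen realising ideles. READING: the window
certificate needs this at `l ≍ √(log q∀)`, exponentially below `l₀(E)` for heavy curves (`not_inSigma8_datum_of_heavy_of_le`) — so this is NOT abc; it is the
kernel form of «Q3 YES per datum ⟹ the S_H body per datum in the tail». [cite: Mochizuki2012, IUTchIII Cor. 3.12 pp. 173–174; IUTchIV Cor. 2.2 (ii) p. 45]
[cite: SilvermanAEC2009, VIII.8] [claim: Mochizuki2012, status: disputed] -/
theorem exists_l0_qRegion_subset_thetaHull_of_isGalois :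
    ∃ l₀ : ℕ, ∀ l : ℕ, l₀ ≤ l →
      ∀ (K Fbar : Type) [Field K] [NumberField K] [Algebra F K] [Field Fbar] [Algebra F Fbar] [Algebra K Fbar]
        (Pb : BadPlacePredicates K) (D : InitialThetaData F K Fbar E l Pb), IsGalois ℚ K →
        ∀ (M : Type) [Field M] [NumberField M]
          (archPk : ∀ (j : (thetaIndex (pilotDataOfK D K)).Label) (vQ : (thetaIndex (pilotDataOfK D K)).VQ),
            Set ((logShellsDH (pilotDataOfK D K) (analyticLogv K)).Packet j vQ))
          (archSub : ∀ (j : (thetaIndex (pilotDataOfK D K)).Label) (v : (thetaIndex (pilotDataOfK D K)).V),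
            Set ((logShellsDH (pilotDataOfK D K) (analyticLogv K)).Packet j ((thetaIndex (pilotDataOfK D K)).over v)))
          (Ψ : ℤ → ∀ v : (thetaIndex (pilotDataOfK D K)).V, v ∈ (thetaIndex (pilotDataOfK D K)).Vbad →
            Set ((logShellsDH (pilotDataOfK D K) (analyticLogv K)).StarPacket v))
          (act : ℤ → ∀ v : (thetaIndex (pilotDataOfK D K)).V, v ∈ (thetaIndex (pilotDataOfK D K)).Vbad →
            (logShellsDH (pilotDataOfK D K) (analyticLogv K)).StarPacket v →
              Module.End ℚ ((logShellsDH (pilotDataOfK D K) (analyticLogv K)).StarPacket v))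
          (Mmod : ℤ → ∀ j : (thetaIndex (pilotDataOfK D K)).LabelStar, Set ((logShellsDH (pilotDataOfK D K) (analyticLogv K)).GlobalPacket j.1))
          (region : ℤ → ∀ j : (thetaIndex (pilotDataOfK D K)).LabelStar, FinDivisor M → ∀ vQ : (thetaIndex (pilotDataOfK D K)).VQ,
            Set ((logShellsDH (pilotDataOfK D K) (analyticLogv K)).Packet j.1 vQ))
          (n : ℤ) (HT : Type) (LogLink : HT → HT → Type) (IsFull : ∀ {s t : HT}, LogLink s t → Prop)
          (lat : LGPGaussianLogThetaLattice LogLink IsFull)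
          (Frd : Type) (IsoF : Frd → Frd → Type) (Ob : Frd → Type) (realify : Frd → Frd) (Strip : Type)
          (IsoS : Strip → Strip → Type)
          (Mv : ∀ v : (thetaIndex (pilotDataOfK D K)).V, v ∈ (thetaIndex (pilotDataOfK D K)).Vbad → Type) [∀ v h, Monoid (Mv v h)]
          (sig : GlobalLGPFrobenioidSignature (thetaIndex (pilotDataOfK D K)).lstar (thetaIndex (pilotDataOfK D K)).V
            (· ∈ (thetaIndex (pilotDataOfK D K)).Vbad) Frd IsoF Ob realify Strip IsoS Mv)
          (split : SplittingMonoids Mv) (ObΔ : Type)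
          (N : ∀ v : (thetaIndex (pilotDataOfK D K)).V, v ∈ (thetaIndex (pilotDataOfK D K)).Vbad → Type) [∀ v h, Monoid (N v h)]
          (qData : QPilotData ObΔ N)
          (col : ℤ → Column (logShellsDH (pilotDataOfK D K) (analyticLogv K)))
          (j : (thetaIndex (pilotDataOfK D K)).Label) (vQ : (thetaIndex (pilotDataOfK D K)).VQ),
          (settingPrVolSharp (pilotDataOfK D K) (logvAnalytic_analyticLogv (F := K)) M archPk archSub Ψ act Mmod region n lat sig split
              qData (exists_realising_qIdeles_pilotDataOfK D).choose (exists_realising_thetaIdeles_pilotDataOfK D).choose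
              (exists_realising_qIdeles_pilotDataOfK D).choose_spec.1 (exists_realising_qIdeles_pilotDataOfK D).choose_spec.2.1).qRegion j vQ ⊆
            (settingPrVolSharp (pilotDataOfK D K) (logvAnalytic_analyticLogv (F := K)) M archPk archSub Ψ act Mmod region n lat sig split
              qData (exists_realising_qIdeles_pilotDataOfK D).choose (exists_realising_thetaIdeles_pilotDataOfK D).choose
              (exists_realising_qIdeles_pilotDataOfK D).choose_spec.1 (exists_realising_qIdeles_pilotDataOfK D).choose_spec.2.1).thetaHull j vQ := by
  obtain ⟨l₀, h⟩ := lTailSigma8_holds F E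
  refine ⟨l₀, fun l hl K Fbar _ _ _ _ _ _ Pb D hGal M _ _ archPk archSub Ψ act Mmod region n HT LogLink IsFull lat Frd IsoF Ob realify Strip IsoS
    Mv _ sig split ObΔ N _ qData col j vQ => ?_⟩
  exact qRegion_subset_thetaHull_pilotDataOfK_chosen_of_inSigma8 D M archPk archSub Ψ act Mmod region n lat sig split qData col
    (h l hl K Fbar Pb D hGal) j vQ

end Curve

end Summit.ABC.IUTFork.Repair.RH.Q3LTailSigma8

end
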